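import Literature.MathematicalPhysics.QuantumLattice.InterClusterKernelSymmetries
import HarnessLib

/-!
# Route `LevyLogBootstrap` / `AnisotropyChord`, crux `DressHalfFilled` (stmt-HubbardSuperconductivity-8148), stub 1
# `stub_plaquetteData`, certificate (W1): the CUT (truncation) selection rule of the column-summed pair resolvent

Support file (`--supports stmt-HubbardSuperconductivity-8148`). In the certified evaluation of Kato's two-plaquette
kernel the pair resolvent `K(E; a, b; c, d) = Σ_{s,t} ⟨a, P_s b⟩ ⟨c, P_t d⟩ / (s + t − E)` (`pairResolvent`,
spectral form `pairResolvent_eq_sum_eigenProj`, `P_s = eigenProj H s`) of a Hermitian `H` is summed over columns of two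
operator insertions, `Σ_{l', l} K(E; A'_{·l'}, A_{·l}; e_{l'}, e_l)`. Let `p₁`, `p₂` be two sets of indices that
`H` does not leave (`H j k = 0` for `j ∉ p`, `k ∈ p`; `H` Hermitian, so the diagonal projection onto `p` COMMUTES
with `H`, hence with every eigenprojection: `eigenProj_apply_eq_zero_of_cut`). If `A'` is supported on `p₁ × p₂` and
`A` vanishes on `p₁ × p₂`, the column sum vanishes term by term (`pairResolvent_colSum_eq_zero_of_cut`): for a column
`l ∈ p₂` the first factor `⟨A'_{·l'}, P_s A_{·l}⟩` pairs a vector supported on `p₁` with the `P_s`-image of one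
supported off `p₁`; for `l ∉ p₂ ∋ l'` the second factor `⟨e_{l'}, P_t e_l⟩ = (P_t)_{l' l}` crosses the `p₂` cut; for
`l, l' ∉ p₂` the column `A'_{·l'}` is zero.

The registered sub-goal `dressHalfFilled_w1_pairResolventMatEqZeroOfTrunc` (signature verbatim as registered on the
item) is the closed form; its energy hypotheses (sector floors `θ₁`, `θ₂` and `E < θ₁ + θ₂`, under which the
registering seat intended a resolvent-truncation argument) are not needed for the conclusion and are left unused.

References: T. Kato, Perturbation Theory for Linear Operators (1966), I-§5.3 (5.26)–(5.32) [Kato1966]; W.-F. Tsai,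
S. A. Kivelson, PRB 73 (2006) 214510, App. A (A1) [TsaiKivelson2006]. No definition and no named fact is introduced;
all statements are [folklore] linear algebra.
-/

set_option linter.dupNamespace false

noncomputable section

namespace Summit.HubbardSuperconductivity.HubbardSuperconductivity.Theorems.LevyLogBootstrap

open Matrix Finset Literature.MathematicalPhysics.QuantumLattice

section Cut

variable {m : Type*} [Fintype m]

/-- A matrix whose entries vanish across a cut (`P i i' = 0` for `i ∈ p`, `i' ∉ p`) has no matrix element between a
vector supported on `p` and one supported off `p`: `⟨x, P y⟩ = 0`. [folklore] -/
theorem star_dotProduct_mulVec_eq_zero_of_cut {P : Matrix m m ℂ} (p : m → Prop)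
    (hP : ∀ i i', p i → ¬p i' → P i i' = 0) {x y : m → ℂ} (hx : ∀ j, ¬p j → x j = 0)
    (hy : ∀ j, p j → y j = 0) : star x ⬝ᵥ (P *ᵥ y) = 0 := by
  rw [dotProduct]
  refine Finset.sum_eq_zero fun i _ => ?_
  by_cases hi : p i
  · have h0 : (P *ᵥ y) i = 0 := by
      rw [Matrix.mulVec, dotProduct]
      refine Finset.sum_eq_zero fun i' _ => ?_
      by_cases hi' : p i'
      · rw [hy i' hi', mul_zero]
      · rw [hP i i' hi hi', zero_mul]
    rw [h0, mul_zero]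
  · rw [Pi.star_apply, hx i hi, star_zero, zero_mul]

variable [DecidableEq m]

/-- **Eigenprojections respect a cut that the Hermitian matrix respects.** If `H j k = 0` for `j ∉ p`, `k ∈ p`
(`H` maps the coordinate subspace of `p` into itself) and `H` is Hermitian, then the diagonal projection onto `p`
commutes with `H`, hence with every eigenprojection `P_s = eigenProj H s` (Kato 1966, I-(5.26)), so
`(P_s) i i' = 0` for `i ∈ p`, `i' ∉ p`. [cite: Kato1966, I-§5.3 (5.26)] -/
theorem eigenProj_apply_eq_zero_of_cut {H : Matrix m m ℂ} (hH : H.IsHermitian) (p : m → Prop) [DecidablePred p]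
    (hcut : ∀ j k, ¬p j → p k → H j k = 0) (s : ℝ) (i i' : m) (hi : p i) (hi' : ¬p i') :
    eigenProj H s i i' = 0 := by
  set D : Matrix m m ℂ := Matrix.diagonal fun j => if p j then (1 : ℂ) else 0 with hD
  have hDH : Commute D H := by
    change D * H = H * D
    ext j k
    rw [hD, Matrix.diagonal_mul, Matrix.mul_diagonal]
    by_cases hj : p j
    · by_cases hk : p k
      · rw [if_pos hj, if_pos hk, one_mul, mul_one]
      · rw [if_pos hj, if_neg hk, one_mul, mul_zero, ← hH.apply j k, hcut k j hk hj, star_zero]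
    · by_cases hk : p k
      · rw [if_neg hj, if_pos hk, zero_mul, mul_one, hcut j k hj hk]
      · rw [if_neg hj, if_neg hk, zero_mul, mul_zero]
  have hC : eigenProj H s * D = D * eigenProj H s := (commute_eigenProj_of_commute hDH s).eq
  have h := congrFun (congrFun hC i) i'
  rw [hD, Matrix.mul_diagonal, Matrix.diagonal_mul, if_neg hi', if_pos hi, mul_zero, one_mul] at h
  exact h.symm

/-- **Cut selection rule of the column-summed pair resolvent.** For a Hermitian `H` respecting the cuts `p₁` and
`p₂`, an insertion `A'` supported on `p₁ × p₂` and an insertion `A` vanishing on `p₁ × p₂`: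
`Σ_{l', l} K(E; A'_{·l'}, A_{·l}; e_{l'}, e_l) = 0` (every spectral term vanishes).
[cite: TsaiKivelson2006, App. A (A1)] -/
theorem pairResolvent_colSum_eq_zero_of_cut {H : Matrix m m ℂ} (hH : H.IsHermitian) (p₁ p₂ : m → Prop)
    [DecidablePred p₁] [DecidablePred p₂] (hH₁ : ∀ j k, ¬p₁ j → p₁ k → H j k = 0)
    (hH₂ : ∀ j k, ¬p₂ j → p₂ k → H j k = 0) (E : ℝ) {A' : Matrix m m ℂ}
    (hA' : ∀ i j, ¬(p₁ i ∧ p₂ j) → A' i j = 0) {A : Matrix m m ℂ} (hA : ∀ i j, p₁ i → p₂ j → A i j = 0) :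
    (∑ l', ∑ l, pairResolvent hH E (fun i => A' i l') (fun i => A i l) (Pi.single l' 1) (Pi.single l 1)) = 0 := by
  refine Finset.sum_eq_zero fun l' _ => Finset.sum_eq_zero fun l _ => ?_
  rw [pairResolvent_eq_sum_eigenProj]
  refine Finset.sum_eq_zero fun s _ => Finset.sum_eq_zero fun t _ => ?_
  by_cases h₂l : p₂ l
  · -- the column `A_{·l}` is supported off `p₁`, the column `A'_{·l'}` on `p₁`
    rw [star_dotProduct_mulVec_eq_zero_of_cut p₁ (eigenProj_apply_eq_zero_of_cut hH p₁ hH₁ s)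
        (fun j hj => hA' j l' fun h => hj h.1) (fun j hj => hA j l hj h₂l), zero_mul, zero_mul]
  · by_cases h₂l' : p₂ l'
    · -- the unit vectors `e_{l'}`, `e_l` lie on opposite sides of the `p₂` cut
      rw [star_dotProduct_mulVec_eq_zero_of_cut p₂ (eigenProj_apply_eq_zero_of_cut hH p₂ hH₂ t)
          (fun j hj => Pi.single_eq_of_ne (fun h => hj (by rw [h]; exact h₂l')) _)
          (fun j hj => Pi.single_eq_of_ne (fun h => h₂l (by rw [← h]; exact hj)) _), mul_zero, zero_mul]
    · -- the column `A'_{·l'}` vanishes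
      have ha : (fun i => A' i l') = 0 := funext fun i => hA' i l' fun h => h₂l' h.2
      rw [ha, star_zero, zero_dotProduct, zero_mul, zero_mul]

end Cut

/-! ### Registered form -/

set_option linter.style.longLine false in
/-- **Registered sub-goal `dressHalfFilled_w1_pairResolventMatEqZeroOfTrunc`** (closed form, signature verbatim as
registered on the crux item stmt-HubbardSuperconductivity-8148): the cut selection rule of the column-summed pair
resolvent of a Hermitian `H` respecting two index cuts `p₁`, `p₂` (the sector floors `θ₁`, `θ₂` and `E < θ₁ + θ₂`
of the registered statement are not used). [cite: Kato1966, I-§5.3 (5.26)] -/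
theorem dressHalfFilled_w1_pairResolventMatEqZeroOfTrunc : ∀ {m : Type} [Fintype m] [DecidableEq m] {H : Matrix m m ℂ} (hH : H.IsHermitian) (p₁ p₂ : m → Prop) [DecidablePred p₁] [DecidablePred p₂], (∀ j k, ¬ p₁ j → p₁ k → H j k = 0) → (∀ j k, ¬ p₂ j → p₂ k → H j k = 0) → ∀ {θ₁ θ₂ E : ℝ}, (∀ u : m → ℂ, (∀ j, ¬ p₁ j → u j = 0) → θ₁ * (star u ⬝ᵥ u).re ≤ (star u ⬝ᵥ H *ᵥ u).re) → (∀ u : m → ℂ, (∀ j, ¬ p₂ j → u j = 0) → θ₂ * (star u ⬝ᵥ u).re ≤ (star u ⬝ᵥ H *ᵥ u).re) → E < θ₁ + θ₂ → ∀ {A' : Matrix m m ℂ}, (∀ i j, ¬ (p₁ i ∧ p₂ j) → A' i j = 0) → ∀ {A : Matrix m m ℂ}, (∀ i j, p₁ i → p₂ j → A i j = 0) → (∑ l', ∑ l, pairResolvent hH E (fun i => A' i l') (fun i => A i l) (Pi.single l' 1) (Pi.single l 1)) = 0 := by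
  intro m _ _ H hH p₁ p₂ _ _ hH₁ hH₂ _ _ E _ _ _ A' hA' A hA
  exact pairResolvent_colSum_eq_zero_of_cut hH p₁ p₂ hH₁ hH₂ E hA' hA

end Summit.HubbardSuperconductivity.HubbardSuperconductivity.Theorems.LevyLogBootstrap

end
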